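import Mathlib.Analysis.Convolution
import Mathlib.Analysis.Calculus.ContDiff.Convolution
import Mathlib.Analysis.Calculus.BumpFunction.Convolution
import Mathlib.Analysis.Calculus.BumpFunction.FiniteDimension
import Literature.Analysis.FunctionSpaces.SobolevDomainProofs
import Literature.Analysis.UnboundedOperators.HeatKernel
import HarnessLib

/-!
# Mollification (Friedrichs regularisation) and weak derivatives on the whole space

Analysis/FunctionSpaces support file (serves the discharge of the Serrin–Prodi weak–strong
uniqueness theorem `Literature.Analysis.FluidPDE.weak_strong_uniqueness`, whose proof regularises Leray–Hopf solutions
by convolution with smooth kernels; Serrin 1963, §§3–4).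

Let `E` be a finite-dimensional real inner product space with its Lebesgue measure `volume`, `F` a
real normed space (complete where limits are taken), `φ ∈ C_c^∞(E; ℝ)` a kernel and `f : E → F`
locally integrable. The
mollification is Mathlib's convolution `φ ⋆ f = φ ⋆[lsmul ℝ ℝ, volume] f`,
`(φ ⋆ f)(x) = ∫ φ(t) f(x - t) dt`. This file proves the textbook properties of mollifiers that
involve **weak derivatives** in the sense of the accepted `Literature.Analysis.FunctionSpaces.HasWeakFDerivOn` (`SobolevDomain`),
which Mathlib does not have:

* `Literature.Analysis.FunctionSpaces.HasWeakFDerivOn.hasFDerivAt_convolution`: if `g` is a weak derivative of `f` on the whole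
  space then `φ ⋆ f` is differentiable with `D(φ ⋆ f)(x) = (φ ⋆ g)(x)` — "mollification commutes
  with weak differentiation" (Evans, *PDE*, §5.3.1, Thm. 1, step 1; Adams, *Sobolev spaces*,
  Lemma 3.15 (3.16)); componentwise form `fderiv_convolution_apply`.
* smoothness `contDiff_convolution` (Mathlib's `HasCompactSupport.contDiff_convolution_left`,
  restated for locally integrable `f` in the whole-space weak-derivative setting) and the `L^p`
  contraction `eLpNorm_normed_convolution_le` for normalised bump kernels (`∫ φ = 1`, `φ ≥ 0`;
  Young's inequality from the accepted `Literature.Analysis.UnboundedOperators.eLpNorm_convolution_le_lintegral_enorm_mul`).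
* `Literature.Analysis.FunctionSpaces.exists_contDiffBump_seq`: a sequence of bump functions `φₙ` with outer radius `→ 0` and
  bounded ratio of radii, so that Mathlib's Lebesgue-differentiation lemma
  `ContDiffBump.ae_convolution_tendsto_right_of_locallyIntegrable` applies: `φₙ ⋆ f → f` a.e.

## Mathlib search

Mathlib (this pin) has the convolution `MeasureTheory.convolution` with derivative and smoothness
under compactly supported smooth kernels (`HasCompactSupport.hasFDerivAt_convolution_left`,
`HasCompactSupport.contDiff_convolution_left`), normalised bump functions `ContDiffBump.normed`
and the a.e. convergence `ContDiffBump.ae_convolution_tendsto_right_of_locallyIntegrable`; it has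
no weak derivatives (searched `weak derivative`, `HasWeakDeriv`, `distributional derivative` in
`Analysis/`: only the bundled distributions of `Mathlib/Analysis/Distribution/`, without an `L¹_loc`
weak-derivative predicate) and hence no "convolution commutes with weak derivatives". Young's
convolution inequality is taken from the tree (`Literature/Analysis/UnboundedOperators/HeatKernel`,
`Literature.Analysis.UnboundedOperators.eLpNorm_convolution_le_lintegral_enorm_mul`, `Literature.Analysis.UnboundedOperators.memLp_convolution_lsmul`).

## References

* L. C. Evans, *Partial Differential Equations*, 2nd ed. (AMS 2010), App. C.4, Thm. 7 (properties
  of mollifiers) and §5.3.1, Thm. 1 (local approximation by smooth functions: `Dᵅ(η_ε ⋆ u) =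
  η_ε ⋆ Dᵅu`).
* R. A. Adams, *Sobolev Spaces* (Academic Press 1975), Lemma 2.18 (mollifiers on `L^p`) and
  Lemma 3.15 (mollification and weak derivatives).
* J. Serrin, *The initial value problem for the Navier–Stokes equations*, in: Nonlinear Problems
  (Madison 1962), Univ. Wisconsin Press 1963, §3 (regularisation of weak solutions).
-/

noncomputable section

open MeasureTheory TopologicalSpace Set Function Filter Topology ContinuousLinearMap Metric
open scoped ENNReal NNReal Convolution ContDiff

namespace Literature.Analysis.FunctionSpaces

variable {E : Type*} [NormedAddCommGroup E] [InnerProductSpace ℝ E] [FiniteDimensional ℝ E]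
  [MeasurableSpace E] [BorelSpace E]
variable {F : Type*} [NormedAddCommGroup F] [NormedSpace ℝ F]

/-! ### Test functions: translates and reflections -/

omit [MeasurableSpace E] [BorelSpace E] [FiniteDimensional ℝ E] in
/-- The reflected translate `y ↦ φ (x - y)` of a test function on the whole space is a test
function on the whole space (Evans, *PDE*, App. C.4). [folklore] -/
theorem IsTestFunctionOn.comp_sub_left {φ : E → ℝ} (hφ : IsTestFunctionOn (⊤ : Opens E) φ)
    (x : E) : IsTestFunctionOn (⊤ : Opens E) fun y => φ (x - y) where
  contDiff := hφ.contDiff.comp (contDiff_const.sub contDiff_id)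
  hasCompactSupport := hφ.hasCompactSupport.comp_homeomorph (Homeomorph.subLeft x)
  tsupport_subset := by simp

omit [MeasurableSpace E] [BorelSpace E] [FiniteDimensional ℝ E] [InnerProductSpace ℝ E] in
/-- Derivative of the reflected translate: `D(φ(x - ·))(y) v = -Dφ(x - y) v`. [folklore] -/
theorem fderiv_comp_sub_left_apply [NormedSpace ℝ E] {φ : E → ℝ} (hφ : ContDiff ℝ 1 φ)
    (x y v : E) : fderiv ℝ (fun z => φ (x - z)) y v = -fderiv ℝ φ (x - y) v := by
  have h : HasFDerivAt (fun z => φ (x - z)) ((fderiv ℝ φ (x - y)).comp (-ContinuousLinearMap.id ℝ E)) y := by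
    have h1 : HasFDerivAt (fun z : E => x - z) (-ContinuousLinearMap.id ℝ E) y :=
      (hasFDerivAt_id y).const_sub x
    exact ((hφ.differentiable one_ne_zero) _).hasFDerivAt.comp y h1
  rw [h.fderiv]
  simp

/-! ### Mollification commutes with weak differentiation -/

section WeakDeriv

variable {f : E → F} {g : E → E →L[ℝ] F} {φ : E → ℝ}

/-- The defining identity of a whole-space weak derivative tested against a reflected translate
`φ(x - ·)` of a test function: `∫ Dφ(x - y) v • f y dy = ∫ φ(x - y) • g y v dy` (the two minus
signs — from the chain rule and from the integration by parts — cancel). This is the computation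
behind `D(φ ⋆ f) = φ ⋆ Df` (Evans, *PDE*, §5.3.1, proof of Thm. 1). [folklore] -/
theorem HasWeakFDerivOn.integral_fderiv_comp_sub_smul
    (hw : HasWeakFDerivOn (⊤ : Opens E) volume f g) (hφ : IsTestFunctionOn (⊤ : Opens E) φ)
    (x v : E) : ∫ y, (fderiv ℝ φ (x - y) v) • f y = ∫ y, φ (x - y) • g y v := by
  have key := hw.integral_fderiv_smul_eq (fun y => φ (x - y)) v (hφ.comp_sub_left x)
  simp only [Opens.coe_top, Measure.restrict_univ] at key
  have hφ1 : ContDiff ℝ 1 φ := hφ.contDiff.of_le (by exact_mod_cast le_top)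
  simp only [fderiv_comp_sub_left_apply hφ1, neg_smul, integral_neg, neg_inj] at key
  exact key

/-- **Mollification commutes with weak differentiation.** Let `f : E → F` have the weak
derivative `g` on the whole space (accepted `Literature.HasWeakFDerivOn ⊤ volume f g`) and let `φ` be a
test function. Then the mollification `φ ⋆ f` is differentiable at every point with Fréchet
derivative the mollified weak derivative: `D(φ ⋆ f)(x) = (φ ⋆ g)(x) = ∫ φ(t) g(x - t) dt`
(Evans, *PDE*, §5.3.1, Thm. 1 (i): `Dᵅ u^ε = η_ε ⋆ Dᵅ u`; Adams 1975, Lemma 3.15). Proof: Mathlib's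
`HasCompactSupport.hasFDerivAt_convolution_left` gives `D(φ ⋆ f) = (Dφ) ⋆ f`, and the defining
identity of the weak derivative against the test function `φ(x - ·)`
(`integral_fderiv_comp_sub_smul`) identifies `((Dφ) ⋆ f)(x) v` with `(φ ⋆ g)(x) v`. [cite: Evans2010, §5.3.1 Thm. 1] -/
theorem HasWeakFDerivOn.hasFDerivAt_convolution
    (hw : HasWeakFDerivOn (⊤ : Opens E) volume f g) (hφ : IsTestFunctionOn (⊤ : Opens E) φ)
    (x : E) :
    HasFDerivAt (φ ⋆[lsmul ℝ ℝ, volume] f) ((φ ⋆[lsmul ℝ ℝ, volume] g) x) x := by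
  have hf : LocallyIntegrable f volume := locallyIntegrableOn_univ.1 (by
    simpa only [Opens.coe_top] using hw.locallyIntegrableOn)
  have hg : LocallyIntegrable g volume := locallyIntegrableOn_univ.1 (by
    simpa only [Opens.coe_top] using hw.locallyIntegrableOn_deriv)
  have hφ1 : ContDiff ℝ 1 φ := hφ.contDiff.of_le (by exact_mod_cast le_top)
  have hφc : HasCompactSupport φ := hφ.hasCompactSupport
  have hD := hφc.hasFDerivAt_convolution_left (lsmul ℝ ℝ) hφ1 hf x
  suffices heq : (fderiv ℝ φ ⋆[(lsmul ℝ ℝ : ℝ →L[ℝ] F →L[ℝ] F).precompL E, volume] f) x =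
      (φ ⋆[lsmul ℝ ℝ, volume] g) x by
    rwa [heq] at hD
  have hint : ConvolutionExistsAt (fderiv ℝ φ) f x
      ((lsmul ℝ ℝ : ℝ →L[ℝ] F →L[ℝ] F).precompL E) volume :=
    (hφc.fderiv ℝ).convolutionExists_left _ (hφ1.continuous_fderiv one_ne_zero) hf x
  have hint' : ConvolutionExistsAt φ g x (lsmul ℝ ℝ) volume :=
    hφc.convolutionExists_left _ hφ.contDiff.continuous hg x
  ext v
  rw [convolution_def, ContinuousLinearMap.integral_apply hint.integrable v, convolution_def,
    ContinuousLinearMap.integral_apply hint'.integrable v]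
  simp only [precompL_apply, lsmul_apply, _root_.FunLike.coe_smul, Pi.smul_apply]
  have h1 : ∫ t, (fderiv ℝ φ t v) • f (x - t) = ∫ y, (fderiv ℝ φ (x - y) v) • f y := by
    rw [← integral_sub_left_eq_self (fun t => (fderiv ℝ φ t v) • f (x - t)) volume x]
    simp only [sub_sub_cancel]
  have h2 : ∫ t, φ t • g (x - t) v = ∫ y, φ (x - y) • g y v := by
    rw [← integral_sub_left_eq_self (fun t => φ t • g (x - t) v) volume x]
    simp only [sub_sub_cancel]
  rw [h1, h2]
  exact hw.integral_fderiv_comp_sub_smul hφ x v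

/-- Componentwise form of `hasFDerivAt_convolution`: for a whole-space weak derivative `g` of `f`
and a test function `φ`, `D(φ ⋆ f)(x) v = (φ ⋆ (g · v))(x)` (Evans, *PDE*, §5.3.1, Thm. 1 (i)). [cite: Evans2010, §5.3.1 Thm. 1] -/
theorem HasWeakFDerivOn.fderiv_convolution_apply
    (hw : HasWeakFDerivOn (⊤ : Opens E) volume f g) (hφ : IsTestFunctionOn (⊤ : Opens E) φ)
    (x v : E) :
    fderiv ℝ (φ ⋆[lsmul ℝ ℝ, volume] f) x v = (φ ⋆[lsmul ℝ ℝ, volume] fun y => g y v) x := by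
  have hg : LocallyIntegrable g volume := locallyIntegrableOn_univ.1 (by
    simpa only [Opens.coe_top] using hw.locallyIntegrableOn_deriv)
  have hint' : ConvolutionExistsAt φ g x (lsmul ℝ ℝ) volume :=
    hφ.hasCompactSupport.convolutionExists_left _ hφ.contDiff.continuous hg x
  rw [(hw.hasFDerivAt_convolution hφ x).fderiv, convolution_def,
    ContinuousLinearMap.integral_apply hint'.integrable v, convolution_def]
  simp only [lsmul_apply, _root_.FunLike.coe_smul, Pi.smul_apply]

/-- The mollification of a function with a whole-space weak derivative is `C¹` (indeed `C^∞`,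
`contDiff_convolution`); recorded in the form used to feed `C¹` Sobolev inequalities. [folklore] -/
theorem HasWeakFDerivOn.contDiff_convolution {n : ℕ∞}
    (hw : HasWeakFDerivOn (⊤ : Opens E) volume f g) (hφ : IsTestFunctionOn (⊤ : Opens E) φ) :
    ContDiff ℝ n (φ ⋆[lsmul ℝ ℝ, volume] f) := by
  have hf : LocallyIntegrable f volume := locallyIntegrableOn_univ.1 (by
    simpa only [Opens.coe_top] using hw.locallyIntegrableOn)
  exact hφ.hasCompactSupport.contDiff_convolution_left _ (hφ.contDiff.of_le (by exact_mod_cast le_top)) hf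

end WeakDeriv

/-! ### Normalised bump kernels: test functions, `L^p` contraction, a.e. convergence -/

section Bump

/-- The normalised bump function `φ.normed volume` (`= φ / ∫ φ`, Mathlib `ContDiffBump.normed`)
of a bump `φ` centred at `0` is a test function on the whole space: smooth and compactly
supported (Evans, *PDE*, App. C.4, the standard mollifier `η_ε`). [folklore] -/
theorem isTestFunctionOn_normed (φ : ContDiffBump (0 : E)) :
    IsTestFunctionOn (⊤ : Opens E) (φ.normed volume) where
  contDiff := φ.contDiff_normed
  hasCompactSupport := φ.hasCompactSupport_normed
  tsupport_subset := by simp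

/-- The normalised bump kernel has unit mass in `ℝ≥0∞`: `∫⁻ ‖φ.normed‖ₑ = 1` (it is nonnegative
with `∫ φ.normed = 1`; Evans, *PDE*, App. C.4, `∫ η_ε = 1`). [folklore] -/
theorem lintegral_enorm_normed (φ : ContDiffBump (0 : E)) :
    ∫⁻ y, ‖φ.normed volume y‖ₑ = 1 := by
  have h : ∀ y, ‖φ.normed volume y‖ₑ = ENNReal.ofReal (φ.normed volume y) := fun y =>
    (Real.enorm_eq_ofReal (φ.nonneg_normed y))
  simp_rw [h]
  rw [← ofReal_integral_eq_lintegral_ofReal φ.integrable_normed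
    (Eventually.of_forall φ.nonneg_normed), φ.integral_normed, ENNReal.ofReal_one]

/-- **Mollification does not increase `L^p` norms** (Young's inequality with a unit-mass
kernel): `‖φ.normed ⋆ h‖_{L^p} ≤ ‖h‖_{L^p}` for `1 ≤ p ≤ ∞` and a.e.-strongly measurable `h`
(Evans, *PDE*, App. C.4, Thm. 7 (proof of (iv)); Adams 1975, Lemma 2.18 (a)). Real proof from
the accepted `Literature.Analysis.UnboundedOperators.eLpNorm_convolution_le_lintegral_enorm_mul`. [cite: Evans2010, App. C.4 Thm. 7] -/
theorem eLpNorm_normed_convolution_le (φ : ContDiffBump (0 : E)) {h : E → F}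
    (hh : AEStronglyMeasurable h volume) {p : ℝ≥0∞} (hp : 1 ≤ p) :
    eLpNorm (φ.normed volume ⋆[lsmul ℝ ℝ, volume] h) p volume ≤ eLpNorm h p volume := by
  have := UnboundedOperators.eLpNorm_convolution_le_lintegral_enorm_mul (μ := volume) (K := φ.normed volume)
    (φ.contDiff_normed (n := 1)).continuous.aestronglyMeasurable hh hp
  rwa [lintegral_enorm_normed, one_mul] at this

/-- The mollification of an `L^p` function, `1 ≤ p ≤ ∞`, is in `L^p` (Young; Evans, *PDE*,
App. C.4, Thm. 7). Real proof from the accepted `Literature.Analysis.UnboundedOperators.memLp_convolution_lsmul`. [cite: Evans2010, App. C.4 Thm. 7] -/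
theorem memLp_normed_convolution (φ : ContDiffBump (0 : E)) {h : E → F} {p : ℝ≥0∞}
    (hh : MemLp h p volume) (hp : 1 ≤ p) :
    MemLp (φ.normed volume ⋆[lsmul ℝ ℝ, volume] h) p volume :=
  UnboundedOperators.memLp_convolution_lsmul φ.integrable_normed hh hp

omit [MeasurableSpace E] [BorelSpace E] [FiniteDimensional ℝ E] [InnerProductSpace ℝ E] in
/-- **A mollifier sequence.** There is a sequence of bump functions `φₙ` centred at `0` whose
outer radii tend to `0` while the ratio of outer to inner radius stays `≤ 2` (take radii
`1/(n+2) < 1/(n+1)`) — the hypotheses of Mathlib's a.e.-convergence lemma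
`ContDiffBump.ae_convolution_tendsto_right_of_locallyIntegrable` (Evans, *PDE*, App. C.4,
Thm. 7 (ii)–(iii) with `ε = 1/(n+1)`). [folklore] -/
theorem exists_contDiffBump_seq [NormedSpace ℝ E] :
    ∃ φ : ℕ → ContDiffBump (0 : E),
      Tendsto (fun n => (φ n).rOut) atTop (𝓝 0) ∧ ∀ n, (φ n).rOut ≤ 2 * (φ n).rIn := by
  refine ⟨fun n => ⟨1 / ((n : ℝ) + 2), 1 / ((n : ℝ) + 1), by positivity, ?_⟩, ?_, fun n => ?_⟩
  · exact one_div_lt_one_div_of_lt (by positivity) (by linarith)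
  · exact tendsto_one_div_add_atTop_nhds_zero_nat
  · change 1 / ((n : ℝ) + 1) ≤ 2 * (1 / ((n : ℝ) + 2))
    rw [mul_one_div, div_le_div_iff₀ (by positivity) (by positivity)]
    linarith

/-- **Mollifications converge a.e.** For a mollifier sequence as in `exists_contDiffBump_seq` and
a locally integrable `h : E → F`, `(φₙ.normed ⋆ h)(x) → h(x)` for a.e. `x` (Lebesgue
differentiation; Evans, *PDE*, App. C.4, Thm. 7 (ii); Mathlib's
`ContDiffBump.ae_convolution_tendsto_right_of_locallyIntegrable` with ratio bound `2`). [cite: Evans2010, App. C.4 Thm. 7] -/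
theorem ae_tendsto_normed_convolution [CompleteSpace F] {φ : ℕ → ContDiffBump (0 : E)}
    (hφ : Tendsto (fun n => (φ n).rOut) atTop (𝓝 0)) (h'φ : ∀ n, (φ n).rOut ≤ 2 * (φ n).rIn)
    {h : E → F} (hh : LocallyIntegrable h volume) :
    ∀ᵐ x ∂(volume : Measure E),
      Tendsto (fun n => ((φ n).normed volume ⋆[lsmul ℝ ℝ, volume] h) x) atTop (𝓝 (h x)) :=
  ContDiffBump.ae_convolution_tendsto_right_of_locallyIntegrable hφ (Eventually.of_forall h'φ) hh

end Bump

end Literature.Analysis.FunctionSpaces
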